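import Mathlib
import Summits.PneNP.PneNP.Theorems.OverlapGapAlgebraSolvableImpliesStableSectionUnitClauseSecondMoment

/-!
# PneNP / OverlapGapAlgebra — crux `SolvableImpliesStableSection` (stmt-PneNP-2463):
# the UNIT CLAUSE block (13/·) — contradiction pairs summed over the instances

Support for crux `stmt-PneNP-2463` (`Summit.PneNP.PneNP.Theses.OverlapGapAlgebra.SolvableImpliesStableSection`),
registered stub `stub_lowDensity` (child G).  Kind (A) of the violated clauses: ordered pairs of distinct
non-muted clauses unit on the SAME variable at round `t + 1`.  By the coupled pair bound
(`sissU_sum_cpair_indicator_le`) and the second moment of the newly set variables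
(`sissU_sum_new_sq_le`):
`#C²·Σ_Φ #pairs ≤ m²·K·K₂·(W² + 2Wa + q)·#Ω` with `K = (k²-k)·2M·n^{k-1}`, `K₂ = k²(k²-k)·2·n^{k-2}` —
against `#C² = (2n)^{2k}` this is `O_{k,α}((W² + q)/n)·#Ω = O(n/R²)·#Ω` per round.

* `sissU_sum_cpairs_le`.
All objects are hypotheses; no definitions; axioms `propext`, `Classical.choice`, `Quot.sound`.
-/

set_option linter.dupNamespace false -- `Summit.PneNP.PneNP.…`: summit = sub-problem (D-0017)

namespace Summit.PneNP.PneNP.Theorems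

open Finset
open scoped Classical

section Contradictions

variable {m k n : ℕ} {R : ℕ}

/-- **Contradiction pairs.** If `Σ_Φ (N^{S'}_t)² ≤ q·#Ω` for every muted set `S'` (and the first moment
is at level `a`), then for every `S` the ordered pairs of distinct non-muted clauses that are unit on the
same variable at round `t + 1` satisfy
`#C²·Σ_Φ #pairs ≤ m²·(K·K₂)·(W² + 2Wa + q)·#Ω`, `K = (k²-k)·2M·n^{k-1}`, `K₂ = k²(k²-k)·2·n^{k-2}`. -/
theorem sissU_sum_cpairs_le
    (st : Finset (Fin m) → ℕ → (Fin m → Fin k → Fin n × Bool) → Fin n → Option Bool)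
    (dm : Finset (Fin m) → ℕ → (Fin m → Fin k → Fin n × Bool) → Fin n → Bool)
    (h0 : ∀ (S : Finset (Fin m)) (Φ : Fin m → Fin k → Fin n × Bool) (v : Fin n), st S 0 Φ v = none)
    (hstep : ∀ (S : Finset (Fin m)) (t : ℕ) (Φ : Fin m → Fin k → Fin n × Bool) (v : Fin n),
      st S (t + 1) Φ v =
        if st S t Φ v = none then
          (if ∃ i : Fin m, i ∉ S ∧ ∃ j : Fin k, (Φ i j).1 = v ∧ ∀ j' : Fin k, j' ≠ j →
              st S t Φ (Φ i j').1 ≠ none ∧ st S t Φ (Φ i j').1 ≠ some (Φ i j').2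
            then some (dm S t Φ v)
            else if (v : ℕ) * R / n = t then some true else none)
        else st S t Φ v)
    (hdm : ∀ (S : Finset (Fin m)) (t : ℕ) (Φ : Fin m → Fin k → Fin n × Bool) (v : Fin n) (i : Fin m)
      (j : Fin k), i ∉ S → (Φ i j).1 = v → st S t Φ v = none →
      (∀ j' : Fin k, j' ≠ j → st S t Φ (Φ i j').1 ≠ none ∧ st S t Φ (Φ i j').1 ≠ some (Φ i j').2) →
      (∀ i' : Fin m, i' ∉ S → (∃ j₁ : Fin k, (Φ i' j₁).1 = v ∧ ∀ j' : Fin k, j' ≠ j₁ →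
        st S t Φ (Φ i' j').1 ≠ none ∧ st S t Φ (Φ i' j').1 ≠ some (Φ i' j').2) → i ≤ i') →
      dm S t Φ v = (Φ i j).2)
    (M : ℝ) (hM : ∀ u s : ℕ, u + s = n → (u : ℝ) * (s : ℝ) ^ (k - 2) ≤ M * (n : ℝ) ^ (k - 1))
    (W : ℝ) (hW : ∀ t : ℕ, ((((univ : Finset (Fin n)).filter fun v : Fin n => (v : ℕ) * R / n = t).card : ℕ) : ℝ) ≤ W)
    (a : ℝ)
    (hN : ∀ (t : ℕ) (S : Finset (Fin m)), ∑ Φ : Fin m → Fin k → Fin n × Bool,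
      (((univ : Finset (Fin m)).filter fun i => i ∉ S ∧ ∃ j : Fin k, st S t Φ (Φ i j).1 = none ∧
        ∀ j' : Fin k, j' ≠ j → st S t Φ (Φ i j').1 ≠ none ∧ st S t Φ (Φ i j').1 ≠ some (Φ i j').2).card : ℝ)
      ≤ a * Fintype.card (Fin m → Fin k → Fin n × Bool))
    (q : ℝ) (t : ℕ)
    (hq : ∀ S' : Finset (Fin m), ∑ Φ : Fin m → Fin k → Fin n × Bool,
      (((univ : Finset (Fin m)).filter fun i => i ∉ S' ∧ ∃ j : Fin k, st S' t Φ (Φ i j).1 = none ∧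
        ∀ j' : Fin k, j' ≠ j → st S' t Φ (Φ i j').1 ≠ none ∧ st S' t Φ (Φ i j').1 ≠ some (Φ i j').2).card : ℝ) ^ 2
      ≤ q * Fintype.card (Fin m → Fin k → Fin n × Bool))
    (S : Finset (Fin m)) :
    (Fintype.card (Fin k → Fin n × Bool) : ℝ) ^ 2 * ∑ Φ : Fin m → Fin k → Fin n × Bool,
      ∑ p ∈ (univ : Finset (Fin m)).offDiag,
        (if (p.1 ∉ S ∧ p.2 ∉ S) ∧ ∃ v : Fin n,
            (∃ j : Fin k, (Φ p.1 j).1 = v ∧ st S (t + 1) Φ v = none ∧ ∀ j' : Fin k, j' ≠ j →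
              st S (t + 1) Φ (Φ p.1 j').1 ≠ none ∧ st S (t + 1) Φ (Φ p.1 j').1 ≠ some (Φ p.1 j').2) ∧
            (∃ j : Fin k, (Φ p.2 j).1 = v ∧ st S (t + 1) Φ v = none ∧ ∀ j' : Fin k, j' ≠ j →
              st S (t + 1) Φ (Φ p.2 j').1 ≠ none ∧ st S (t + 1) Φ (Φ p.2 j').1 ≠ some (Φ p.2 j').2)
          then (1 : ℝ) else 0)
      ≤ ((m : ℝ) * m) * ((((k * k - k : ℕ) : ℝ) * (2 * M * (n : ℝ) ^ (k - 1))) *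
          ((k * k * (k * k - k) * 2 : ℕ) * (n : ℝ) ^ (k - 2))) *
        ((W ^ 2 + 2 * W * a + q) * Fintype.card (Fin m → Fin k → Fin n × Bool)) := by
  have hW0 : 0 ≤ W := le_trans (Nat.cast_nonneg _) (hW 0)
  have hMn : 0 ≤ M * (n : ℝ) ^ (k - 1) := by
    have := hM 0 n (Nat.zero_add n)
    simp only [Nat.cast_zero, zero_mul] at this
    exact this
  have hK0 : 0 ≤ ((k * k - k : ℕ) : ℝ) * (2 * M * (n : ℝ) ^ (k - 1)) :=
    mul_nonneg (Nat.cast_nonneg _) (by rw [mul_assoc]; exact mul_nonneg (by norm_num) hMn)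
  have hnew0 : 0 ≤ (W ^ 2 + 2 * W * a + q) * Fintype.card (Fin m → Fin k → Fin n × Bool) := by
    have := sissU_sum_new_sq_le st dm hstep W hW a hN q t S (hq S)
    exact le_trans (sum_nonneg fun Φ _ => by positivity) this
  rw [sum_comm, mul_sum]
  have hpair : ∀ p ∈ (univ : Finset (Fin m)).offDiag,
      (Fintype.card (Fin k → Fin n × Bool) : ℝ) ^ 2 * ∑ Φ : Fin m → Fin k → Fin n × Bool,
        (if (p.1 ∉ S ∧ p.2 ∉ S) ∧ ∃ v : Fin n,
            (∃ j : Fin k, (Φ p.1 j).1 = v ∧ st S (t + 1) Φ v = none ∧ ∀ j' : Fin k, j' ≠ j →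
              st S (t + 1) Φ (Φ p.1 j').1 ≠ none ∧ st S (t + 1) Φ (Φ p.1 j').1 ≠ some (Φ p.1 j').2) ∧
            (∃ j : Fin k, (Φ p.2 j).1 = v ∧ st S (t + 1) Φ v = none ∧ ∀ j' : Fin k, j' ≠ j →
              st S (t + 1) Φ (Φ p.2 j').1 ≠ none ∧ st S (t + 1) Φ (Φ p.2 j').1 ≠ some (Φ p.2 j').2)
          then (1 : ℝ) else 0)
        ≤ ((((k * k - k : ℕ) : ℝ) * (2 * M * (n : ℝ) ^ (k - 1))) *
            ((k * k * (k * k - k) * 2 : ℕ) * (n : ℝ) ^ (k - 2))) *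
          ((W ^ 2 + 2 * W * a + q) * Fintype.card (Fin m → Fin k → Fin n × Bool)) := by
    intro p hp
    rw [mem_offDiag] at hp
    by_cases hpS : p.1 ∉ S ∧ p.2 ∉ S
    · have h1 := sissU_sum_cpair_indicator_le st dm h0 hstep hdm S t p.1 p.2 hpS.1 hpS.2 hp.2.2
      have hsimp : ∀ Φ : Fin m → Fin k → Fin n × Bool,
          (if (p.1 ∉ S ∧ p.2 ∉ S) ∧ ∃ v : Fin n,
              (∃ j : Fin k, (Φ p.1 j).1 = v ∧ st S (t + 1) Φ v = none ∧ ∀ j' : Fin k, j' ≠ j →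
                st S (t + 1) Φ (Φ p.1 j').1 ≠ none ∧ st S (t + 1) Φ (Φ p.1 j').1 ≠ some (Φ p.1 j').2) ∧
              (∃ j : Fin k, (Φ p.2 j).1 = v ∧ st S (t + 1) Φ v = none ∧ ∀ j' : Fin k, j' ≠ j →
                st S (t + 1) Φ (Φ p.2 j').1 ≠ none ∧ st S (t + 1) Φ (Φ p.2 j').1 ≠ some (Φ p.2 j').2)
            then (1 : ℝ) else 0)
            = (if ∃ v : Fin n,
              (∃ j : Fin k, (Φ p.1 j).1 = v ∧ st S (t + 1) Φ v = none ∧ ∀ j' : Fin k, j' ≠ j →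
                st S (t + 1) Φ (Φ p.1 j').1 ≠ none ∧ st S (t + 1) Φ (Φ p.1 j').1 ≠ some (Φ p.1 j').2) ∧
              (∃ j : Fin k, (Φ p.2 j).1 = v ∧ st S (t + 1) Φ v = none ∧ ∀ j' : Fin k, j' ≠ j →
                st S (t + 1) Φ (Φ p.2 j').1 ≠ none ∧ st S (t + 1) Φ (Φ p.2 j').1 ≠ some (Φ p.2 j').2)
            then (1 : ℝ) else 0) := by
        intro Φ
        simp only [hpS, not_false_eq_true, true_and]
      simp_rw [hsimp]
      rw [sq, mul_assoc]
      refine h1.trans ?_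
      -- `cnt ≤ K·New` and `coupled ≤ K₂·New`
      have hterm : ∀ Φ : Fin m → Fin k → Fin n × Bool,
          ((((k * k - k) * ((2 * ((univ : Finset (Fin n)).filter fun w =>
              st (insert p.2 (insert p.1 S)) (t + 1) Φ w = none).card) *
            ((univ : Finset (Fin n)).filter fun w => st (insert p.2 (insert p.1 S)) t Φ w = none ∧
              st (insert p.2 (insert p.1 S)) (t + 1) Φ w ≠ none).card *
            ((univ : Finset (Fin n)).filter fun w =>
              st (insert p.2 (insert p.1 S)) (t + 1) Φ w ≠ none).card ^ (k - 2)) : ℕ) : ℝ) *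
          ((k * (k * ((k * k - k) * (2 * ((univ : Finset (Fin n)).filter fun w =>
              st (insert p.2 (insert p.1 S)) t Φ w = none ∧ st (insert p.2 (insert p.1 S)) (t + 1) Φ w ≠ none).card *
            ((univ : Finset (Fin n)).filter fun w =>
              st (insert p.2 (insert p.1 S)) (t + 1) Φ w ≠ none).card ^ (k - 2)))) : ℕ) : ℝ))
          ≤ ((((k * k - k : ℕ) : ℝ) * (2 * M * (n : ℝ) ^ (k - 1))) *
              ((k * k * (k * k - k) * 2 : ℕ) * (n : ℝ) ^ (k - 2))) *
            ((((univ : Finset (Fin n)).filter fun w => st (insert p.2 (insert p.1 S)) t Φ w = none ∧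
              st (insert p.2 (insert p.1 S)) (t + 1) Φ w ≠ none).card : ℕ) : ℝ) ^ 2 := by
        intro Φ
        set U := ((univ : Finset (Fin n)).filter fun w => st (insert p.2 (insert p.1 S)) (t + 1) Φ w = none).card
        set Nw := ((univ : Finset (Fin n)).filter fun w => st (insert p.2 (insert p.1 S)) t Φ w = none ∧
          st (insert p.2 (insert p.1 S)) (t + 1) Φ w ≠ none).card
        set St := ((univ : Finset (Fin n)).filter fun w => st (insert p.2 (insert p.1 S)) (t + 1) Φ w ≠ none).card
        have hUS : U + St = n := by
          have := card_filter_add_card_filter_not (s := (univ : Finset (Fin n)))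
            (fun w => st (insert p.2 (insert p.1 S)) (t + 1) Φ w = none)
          rw [card_univ, Fintype.card_fin] at this
          convert this using 2
        have hM' := hM U St hUS
        have hStn : (St : ℝ) ≤ n := by exact_mod_cast (card_filter_le _ _).trans (by rw [card_univ, Fintype.card_fin])
        have hK : (0 : ℝ) ≤ ((k * k - k : ℕ) : ℝ) := Nat.cast_nonneg _
        have hA : (((k * k - k) * ((2 * U) * Nw * St ^ (k - 2)) : ℕ) : ℝ)
            ≤ (((k * k - k : ℕ) : ℝ) * (2 * M * (n : ℝ) ^ (k - 1))) * Nw := by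
          push_cast
          calc ((k * k - k : ℕ) : ℝ) * (2 * (U : ℝ) * Nw * (St : ℝ) ^ (k - 2))
              = ((k * k - k : ℕ) : ℝ) * (2 * ((U : ℝ) * (St : ℝ) ^ (k - 2)) * Nw) := by ring
            _ ≤ ((k * k - k : ℕ) : ℝ) * (2 * (M * (n : ℝ) ^ (k - 1)) * Nw) := by
                refine mul_le_mul_of_nonneg_left ?_ hK
                exact mul_le_mul_of_nonneg_right (mul_le_mul_of_nonneg_left hM' (by norm_num)) (Nat.cast_nonneg _)
            _ = _ := by ring
        have hB : (((k * (k * ((k * k - k) * (2 * Nw * St ^ (k - 2))))) : ℕ) : ℝ)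
            ≤ ((k * k * (k * k - k) * 2 : ℕ) * (n : ℝ) ^ (k - 2)) * Nw := by
          push_cast
          have hpow : (St : ℝ) ^ (k - 2) ≤ (n : ℝ) ^ (k - 2) := pow_le_pow_left₀ (Nat.cast_nonneg _) hStn _
          calc (k : ℝ) * ((k : ℝ) * (((k * k - k : ℕ) : ℝ) * (2 * (Nw : ℝ) * (St : ℝ) ^ (k - 2))))
              = ((k : ℝ) * (k : ℝ) * ((k * k - k : ℕ) : ℝ) * 2 * Nw) * (St : ℝ) ^ (k - 2) := by ring
            _ ≤ ((k : ℝ) * (k : ℝ) * ((k * k - k : ℕ) : ℝ) * 2 * Nw) * (n : ℝ) ^ (k - 2) :=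
                mul_le_mul_of_nonneg_left hpow (by positivity)
            _ = _ := by ring
        have hA0 : 0 ≤ (((k * k - k) * ((2 * U) * Nw * St ^ (k - 2)) : ℕ) : ℝ) := Nat.cast_nonneg _
        have hB0 : 0 ≤ (((k * (k * ((k * k - k) * (2 * Nw * St ^ (k - 2))))) : ℕ) : ℝ) := Nat.cast_nonneg _
        calc (((k * k - k) * ((2 * U) * Nw * St ^ (k - 2)) : ℕ) : ℝ) *
              (((k * (k * ((k * k - k) * (2 * Nw * St ^ (k - 2))))) : ℕ) : ℝ)
            ≤ ((((k * k - k : ℕ) : ℝ) * (2 * M * (n : ℝ) ^ (k - 1))) * Nw) *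
                (((k * k * (k * k - k) * 2 : ℕ) * (n : ℝ) ^ (k - 2)) * Nw) :=
              mul_le_mul hA hB hB0 (le_trans hA0 hA)
          _ = _ := by ring
      refine (sum_le_sum fun Φ _ => hterm Φ).trans ?_
      rw [← mul_sum]
      refine mul_le_mul_of_nonneg_left ?_ (mul_nonneg hK0 (by positivity))
      exact sissU_sum_new_sq_le st dm hstep W hW a hN q t (insert p.2 (insert p.1 S))
        (hq (insert p.2 (insert p.1 S)))
    · have hzero : ∀ Φ : Fin m → Fin k → Fin n × Bool,
          (if (p.1 ∉ S ∧ p.2 ∉ S) ∧ ∃ v : Fin n,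
              (∃ j : Fin k, (Φ p.1 j).1 = v ∧ st S (t + 1) Φ v = none ∧ ∀ j' : Fin k, j' ≠ j →
                st S (t + 1) Φ (Φ p.1 j').1 ≠ none ∧ st S (t + 1) Φ (Φ p.1 j').1 ≠ some (Φ p.1 j').2) ∧
              (∃ j : Fin k, (Φ p.2 j).1 = v ∧ st S (t + 1) Φ v = none ∧ ∀ j' : Fin k, j' ≠ j →
                st S (t + 1) Φ (Φ p.2 j').1 ≠ none ∧ st S (t + 1) Φ (Φ p.2 j').1 ≠ some (Φ p.2 j').2)
            then (1 : ℝ) else 0) = 0 := by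
        intro Φ
        rw [if_neg (fun h => hpS h.1)]
      simp only [hzero, sum_const_zero, mul_zero]
      exact mul_nonneg (mul_nonneg hK0 (by positivity)) hnew0
  refine (sum_le_sum hpair).trans ?_
  rw [sum_const, nsmul_eq_mul, offDiag_card, card_univ, Fintype.card_fin]
  have hmm : ((m * m - m : ℕ) : ℝ) ≤ (m : ℝ) * m := by
    have := Nat.sub_le (m * m) m
    exact_mod_cast this
  calc ((m * m - m : ℕ) : ℝ) * (((((k * k - k : ℕ) : ℝ) * (2 * M * (n : ℝ) ^ (k - 1))) *
          ((k * k * (k * k - k) * 2 : ℕ) * (n : ℝ) ^ (k - 2))) *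
        ((W ^ 2 + 2 * W * a + q) * Fintype.card (Fin m → Fin k → Fin n × Bool)))
      ≤ ((m : ℝ) * m) * (((((k * k - k : ℕ) : ℝ) * (2 * M * (n : ℝ) ^ (k - 1))) *
          ((k * k * (k * k - k) * 2 : ℕ) * (n : ℝ) ^ (k - 2))) *
        ((W ^ 2 + 2 * W * a + q) * Fintype.card (Fin m → Fin k → Fin n × Bool))) :=
        mul_le_mul_of_nonneg_right hmm (mul_nonneg (mul_nonneg hK0 (by positivity)) hnew0)
    _ = _ := by ring

end Contradictions

end Summit.PneNP.PneNP.Theorems
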